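import Literature.MathematicalPhysics.QuantumLattice.PairCorrelationsProofs
import Literature.MathematicalPhysics.QuantumLattice.FermionOperatorsProofs
import HarnessLib

/-!
# Pair correlations: `Δ_g = P_{φ_g}` for every form factor (proof)

Trunk T-QLATTICE, family `hubbard` (companion of
`Literature.MathematicalPhysics.QuantumLattice.PairCorrelations`, which defines the pair field
`pairField g L = Σ_x localPair g L x` (`Δ_g`), Yang's geminal operator `pairAnnihilator v = P_v`
and the pair wavefunction `pairFieldWavefunction g L = φ_g`, and states the named fact
`pairField_eq_pairAnnihilator g L : Δ_g = P_{φ_g}`; this file only PROVES — it declares no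
definition).

## Contents

* `annihilation_mul_sub_mul_swap`: `c_a c_b - c_c c_d = c_d c_c - c_b c_a`, two instances of the
  canonical anticommutation relation `c_i c_j = -c_j c_i` (`annihilation_anticommute_holds` of
  `FermionOperatorsProofs`);
* the discharge **`pairField_eq_pairAnnihilator_holds`** of the named fact
  `pairField_eq_pairAnnihilator`, for *every* form factor `g : Site 2 → ℝ` and every side `L ≥ 1`
  (the sibling `PairCorrelationsProofs` proves the even case `g (-e) = g e`,
  `pairField_eq_pairAnnihilator_of_even`, by a pure reindexing; the general case needs the CAR).

## Proof

By `pairFieldWavefunction_eq_sum_step` and `pairAnnihilator_sum`, `P_{φ_g} = Σ_e P_{φ_{g,e}}` over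
the steps `e ∈ {0} ∪ unitSteps`, and by `pairAnnihilator_pairFieldWavefunctionStep` (no CAR)
`P_{φ_{g,e}} = Σ_y (g e/√2) (c_{y↑} c_{y-e,↓} - c_{y↓} c_{y-e,↑})`. Substituting `y = x + e` on the
torus `(ℤ/Lℤ)²` and anticommuting both products,
`c_{x+e,↑} c_{x↓} - c_{x+e,↓} c_{x↑} = c_{x↑} c_{x+e,↓} - c_{x↓} c_{x+e,↑}`, which is the
`e`-summand of `localPair g L x`; summing over `x` and `e` gives `Δ_g`.

## Sources

D. J. Scalapino, *The case for d_{x²-y²} pairing in the cuprate superconductors*, Phys. Rep.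
**250** (1995) 329–365: §1, p. 333, Table 1 and eqs. (2)–(4) (gap basis functions of `D₄ₕ`,
`Δ_{x²-y²}(k) = Δ₀ (cos kₓ - cos k_y)`), eqs. (5)–(6) (the `d_{x²-y²}`-wave pair field operator,
written in `k`-space and expanded in the site operators as "a `d_{x²-y²}` linear combination of
singlets between the `l`ᵗʰ lattice site and its four near neighbors"), and Appendix B,
pp. 359–361, eqs. (B.1)–(B.2) (the pair wave function of the condensate). Locator note: the
equations of this paper are numbered globally (§2, "Why might it happen?", pp. 334–343, opens with
the Hubbard Hamiltonian as eq. (7)) and the pair field with its form factor is eqs. (5)–(6) of §1;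
the docstrings of `PairCorrelations` cite the same material as "§2, eq. (2.2)–(2.4)".
S. R. White, D. J. Scalapino, R. L. Sugar, E. Y. Loh, J. E. Gubernatis, R. T. Scalettar,
*Numerical study of the two-dimensional Hubbard model*, Phys. Rev. B **40** (1989) 506, eqs.
(44)–(45) (`Δ_d† = (2√N)⁻¹ Σ_{l,δ} (-1)^δ c†_{l↑} c†_{l+δ,↓}` and the equal-time `d`-wave pair-field
correlation function `D_d = ⟨Δ_d Δ_d†⟩`; reprinted in A. Montorsi (ed.), *The Hubbard Model*,
World Scientific). C. N. Yang, Rev. Mod. Phys. **34** (1962) 694, §4 (geminal expansion of `ρ₂`,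
as cited in `PairCorrelations`). F. H. L. Essler, H. Frahm, F. Göhmann, A. Klümper,
V. E. Korepin, *The One-Dimensional Hubbard Model* (CUP 2005), §2.1 eq. (2.2a)
(`{c_{j,a}, c_{k,b}} = 0`).
-/

noncomputable section

namespace Literature.MathematicalPhysics.QuantumLattice

open Matrix Finset Filter Literature.Probability.LatticeModels
open scoped ComplexOrder

section CAR

variable {ι : Type*} [LinearOrder ι] [Fintype ι]

/-- `c_a c_b - c_c c_d = c_d c_c - c_b c_a`: both products reversed by the canonical
anticommutation relation `{c_i, c_j} = 0`, i.e. `c_i c_j = -c_j c_i`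
(`annihilation_anticommute_holds`). Essler–Frahm–Göhmann–Klümper–Korepin (2005), §2.1,
eq. (2.2a); Bratteli–Robinson II, §5.2.2. [cite: EsslerEtAl2005, §2.1 eq. (2.2a)] -/
theorem annihilation_mul_sub_mul_swap (a b c d : ι) :
    annihilation a * annihilation b - annihilation c * annihilation d =
      annihilation d * annihilation c - annihilation b * annihilation a := by
  rw [eq_neg_of_add_eq_zero_left (annihilation_anticommute_holds (ι := ι) a b),
    eq_neg_of_add_eq_zero_left (annihilation_anticommute_holds (ι := ι) c d), neg_sub_neg]

end CAR

section PairFieldGeminal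

variable (g : Site 2 → ℝ) (L : ℕ) [NeZero L]

/-- **Discharge of the named fact `pairField_eq_pairAnnihilator`**: for every form factor `g` and
every side `L ≥ 1` the pair field is the geminal operator of its pair wavefunction,
`Δ_g = P_{φ_g} = Σ_p φ_g p • c_{p.2} c_{p.1}`. Per step `e ∈ {0} ∪ unitSteps`, the `e`-component
`P_{φ_{g,e}} = Σ_y (g e/√2) (c_{y↑} c_{y-e,↓} - c_{y↓} c_{y-e,↑})`
(`pairAnnihilator_pairFieldWavefunctionStep`) becomes, after the translation `y = x + e` of
`(ℤ/Lℤ)²` and two anticommutations (`annihilation_mul_sub_mul_swap`), the `e`-summand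
`Σ_x (g e/√2) (c_{x↑} c_{x+e,↓} - c_{x↓} c_{x+e,↑})` of `Δ_g`.
Source of the pair field as a form-factor-weighted sum of nearest-neighbour singlet pairs:
Scalapino, Phys. Rep. 250 (1995) 329, §1, eqs. (5)–(6), p. 333 (the `d_{x²-y²}`-wave pair field
operator expanded in site operators; the fact's own docstring says "§2"), with White et al.,
Phys. Rev. B 40 (1989) 506, eq. (45); geminal operators: Yang, Rev. Mod. Phys. 34 (1962) 694, §4.
[cite: Scalapino1995, §1 eqs. (5)–(6), p. 333] -/
theorem pairField_eq_pairAnnihilator_holds : pairField_eq_pairAnnihilator g L := by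
  unfold pairField_eq_pairAnnihilator
  rw [pairFieldWavefunction_eq_sum_step, pairAnnihilator_sum]
  simp only [pairAnnihilator_pairFieldWavefunctionStep]
  unfold pairField localPair
  rw [Finset.sum_comm]
  refine Finset.sum_congr rfl fun e _ => ?_
  refine Fintype.sum_equiv (Equiv.addRight (Torus.proj L e)) _ _ fun x => ?_
  simp only [Equiv.coe_addRight, add_sub_cancel_right]
  rw [annihilation_mul_sub_mul_swap (orb (FermionTorus.ofTorusSite x) 0)]

end PairFieldGeminal

end Literature.MathematicalPhysics.QuantumLattice
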